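import Literature.AlgebraicGeometry.Motives.AbelianVarietyWeilPairingRadicalComposite
import HarnessLib

/-!
# Equal level Weil pairings force linearly equivalent Weil divisors `D_Q = t_Q^*Θ − Θ`
# (Lang VII §2 Prop. 4: perfectness of `e_N` on `A[N] × Pic⁰[N]`)

Topic `AlgebraicGeometry/Motives`; namespace `Literature.AlgebraicGeometry.Motives.AbelianVariety`.
KERNEL ONLY: theorems; no definition, no named fact, no instance, no `sorry`.

S. Lang, *Abelian Varieties*, Ch. VII §2, Prop. 4: «If `e_n(a, ξ) = 1` for all `a ∈ g_n`, then
`ξ = 0`» (the Kummer pairing `e_n : A[n] × {ξ ∈ Pic : nξ = 0} → μ_n` is non-degenerate in `ξ`; the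
tree's `linEquiv_zero_of_forall_kummerConst_eq_one`).  Applied to the class
`ξ = Cl(D^{Θ₂}_{Q₂} − D^{Θ₁}_{Q₁})`, `D^Θ_Q = t_Q^*Θ − Θ`, whose Kummer pairing is the quotient of
the two level Weil pairings `ē^{Θ₂}_N(·, Q₂) / ē^{Θ₁}_N(·, Q₁)` (bilinearity in the divisor, Prop. 3
— the tree's `kummerConst_add`/`kummerConst_neg`): **if `ē^{Θ₂}_N(P, Q₂) = ē^{Θ₁}_N(P, Q₁)` for every
`P ∈ A[N](K)` then `D^{Θ₂}_{Q₂} ∼ D^{Θ₁}_{Q₁}`** — with the Kummer hypotheses on `[N]` explicit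
(`weilDiv_linEquiv_weilDiv_of_forall_weilPairingLevel_eq`) and packaged over an algebraically closed
field in which `N` is invertible (`…_of_isAlgClosed`; the packaging is the tree's, as in
`weilPairingLevel_radical_pow_card_KTheta_of_one_lt`).  Corollary: proportional pairings
`ē^{Θ₂}_N(P, Q) = ē^{Θ₁}_N(P, Q)^a` give `D^{Θ₂}_Q ∼ D^{Θ₁}_{Q^a}` (`…_zpow_of_forall_weilPairingLevel_eq_zpow…`).

Use (cell `hodgecm-mathlib`, W3c (c-iii) step (S2)): read through `IsLambdaOfAt` («`λ̄(Q)` is the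
class of `D^Θ_Q`») and the injectivity of `b ↦ [𝒫|_{A × {b}}]` (★ `DualPair.eq_of_nonempty_iso`), this
turns «Weil-pairing towers proportional by a unit» (★ `exists_isCoprime_weilPairingLevel_pullback_eq_zpow`)
into «`λ₂(Q) = λ₁(Q^{a_M})` on `A[M](ℂ)`», the hypothesis of ★
`HodgeTheory.AbelianVariety.eq_or_eq_neg_of_isIsogeny_of_forall_torsionPoints_map_eq_pow`.

## References
* [Lang1983AbelianVarieties] S. Lang, *Abelian Varieties*, Ch. VII §2, Prop. 3 and Prop. 4
  (PDF pp. 138–140).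
* [Milne1986AbelianVarieties] J. S. Milne, *Abelian varieties*, in Cornell–Silverman (1986), §16
  p. 132 (`ē_m(a, [D])`).
* [MumfordAV1970] D. Mumford, *Abelian Varieties* (1970), §20 (pp. 183–185).
-/

noncomputable section

open CategoryTheory AlgebraicGeometry

universe u

namespace Literature.AlgebraicGeometry.Motives

namespace AbelianVariety

variable {K : Type u} [Field K] {A : AbelianVariety K}

/-! ## §1 With the Kummer hypotheses on `[N]` explicit -/

section Explicit

variable {N : ℕ} [IsDominant (Hom.toSchemeHom ((N : ℤ) • 𝟙 A))]

/-- **Equal level Weil pairings ⇒ linearly equivalent Weil divisors** (Lang VII §2 Prop. 4 applied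
to `ξ = Cl(D^{Θ₂}_{Q₂} - D^{Θ₁}_{Q₁})`): if `ē^{Θ₂}_N(P, Q₂) = ē^{Θ₁}_N(P, Q₁)` for all `P ∈ A[N](K)` then
`t_{Q₂}^*Θ₂ − Θ₂ ∼ t_{Q₁}^*Θ₁ − Θ₁`.  Hypotheses: the Kummer theory of `[N]` (`0 < N`, `[N]` flat and
surjective, `[K(A) : [N]^♯K(A)] = #A[N](K) < ∞`). [cite: Lang1983AbelianVarieties, Ch. VII §2 Prop. 4] -/
theorem weilDiv_linEquiv_weilDiv_of_forall_weilPairingLevel_eq (hN : 0 < N)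
    [Flat (Hom.toSchemeHom ((N : ℤ) • 𝟙 A))] [Surjective (Hom.toSchemeHom ((N : ℤ) • 𝟙 A))]
    [Finite (A.torsionPoints K N)]
    (hdeg : Module.finrank A.X.left.functionField
      (FunctionFieldOver (Hom.toSchemeHom ((N : ℤ) • 𝟙 A))) = Nat.card (A.torsionPoints K N))
    (Θ₁ Θ₂ : CartierDivisor A.X.left) (Q₁ Q₂ : A.torsionPoints K N)
    (h : ∀ P : A.torsionPoints K N, A.weilPairingLevel Θ₂ P Q₂ = A.weilPairingLevel Θ₁ P Q₁) :
    (A.weilDiv Θ₂ Q₂.1).LinEquiv (A.weilDiv Θ₁ Q₁.1) := by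
  -- trivializers of `[N]^* D₂` and `[N]^* (-D₁)`, and of the sum
  have hh := (A.isTrivializer_weilFn Θ₂ Q₂).add (A.isTrivializer_weilFn Θ₁ Q₁).neg
  refine CartierDivisor.LinEquiv.of_add_neg (linEquiv_zero_of_forall_kummerConst_eq_one hN hdeg hh ?_)
  intro P
  rw [kummerConst_add (A.isTrivializer_weilFn Θ₂ Q₂) (A.isTrivializer_weilFn Θ₁ Q₁).neg,
    kummerConst_neg (A.isTrivializer_weilFn Θ₁ Q₁),
    ← weilPairingLevel_eq_kummerConst (A.isTrivializer_weilFn Θ₂ Q₂),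
    ← weilPairingLevel_eq_kummerConst (A.isTrivializer_weilFn Θ₁ Q₁), h P,
    mul_inv_cancel₀ (weilPairingLevel_ne_zero Θ₁ P Q₁)]

end Explicit

/-! ## §2 Over an algebraically closed field with `N` invertible -/

section AlgClosed

variable [IsAlgClosed K]

/-- **Equal level Weil pairings ⇒ linearly equivalent Weil divisors, over `K = K̄` with `N ≠ 0` in
`K`** (the Kummer hypotheses on `[N]` supplied by the tree: `[N]` is an isogeny —
`isIsogeny_zsmul_id_holds` —, flat — `IsIsogeny.flat_toSchemeHom_holds` —, of degree `#A[N](K)` —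
`natCard_torsionPoints_eq_of_isAlgClosed`, `kerRank_zsmul_id_holds`).
[cite: Lang1983AbelianVarieties, Ch. VII §2 Prop. 4] [cite: MumfordAV1970, §20 (pp. 183–185)] -/
theorem weilDiv_linEquiv_weilDiv_of_forall_weilPairingLevel_eq_of_isAlgClosed {N : ℕ} (hNK : (N : K) ≠ 0)
    [IsDominant (Hom.toSchemeHom ((N : ℤ) • 𝟙 A))]
    (Θ₁ Θ₂ : CartierDivisor A.X.left) (Q₁ Q₂ : A.torsionPoints K N)
    (h : ∀ P : A.torsionPoints K N, A.weilPairingLevel Θ₂ P Q₂ = A.weilPairingLevel Θ₁ P Q₁) :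
    (A.weilDiv Θ₂ Q₂.1).LinEquiv (A.weilDiv Θ₁ Q₁.1) := by
  have hN0 : N ≠ 0 := by rintro rfl; exact hNK (by simp)
  have hNZ : ((N : ℕ) : ℤ) ≠ 0 := Int.natCast_ne_zero.mpr hN0
  have hNL : (((N : ℕ) : ℤ) : K) ≠ 0 := by rwa [Int.cast_natCast]
  have hiso : IsIsogeny (((N : ℕ) : ℤ) • 𝟙 A) := isIsogeny_zsmul_id_holds A _ hNZ
  haveI : Surjective (Hom.toSchemeHom (((N : ℕ) : ℤ) • 𝟙 A)) := hiso.1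
  haveI : IsFinite (Hom.toSchemeHom (((N : ℕ) : ℤ) • 𝟙 A)) := hiso.2
  haveI : Flat (Hom.toSchemeHom (((N : ℕ) : ℤ) • 𝟙 A)) := IsIsogeny.flat_toSchemeHom_holds hiso
  have hcard : Nat.card (A.torsionPoints K ((N : ℕ) : ℤ)) = (((N : ℕ)) : ℤ).natAbs ^ (2 * A.dim) :=
    natCard_torsionPoints_eq_of_isAlgClosed A K _ hNL
  haveI : Finite (A.torsionPoints K ((N : ℕ) : ℤ)) :=
    Nat.finite_of_card_ne_zero (by
      rw [hcard, Int.natAbs_natCast]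
      exact pow_ne_zero _ hN0)
  have hdeg : Module.finrank A.X.left.functionField
      (FunctionFieldOver (Hom.toSchemeHom (((N : ℕ) : ℤ) • 𝟙 A))) =
        Nat.card (A.torsionPoints K ((N : ℕ) : ℤ)) := by
    rw [← hiso.kerRank_eq_finrank_functionFieldOver, kerRank_zsmul_id_holds A _ hNZ, hcard]
  exact weilDiv_linEquiv_weilDiv_of_forall_weilPairingLevel_eq (Nat.pos_of_ne_zero hN0) hdeg Θ₁ Θ₂ Q₁ Q₂ h

/-- **Proportional pairings ⇒ `D^{Θ₂}_Q ∼ D^{Θ₁}_{Q^a}`**: over `K = K̄` with `N ≠ 0` in `K`, if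
`ē^{Θ₂}_N(P, Q) = ē^{Θ₁}_N(P, Q)^a` for all `P ∈ A[N](K)` (an integer `a`), then
`t_Q^*Θ₂ − Θ₂ ∼ t_{Q^a}^*Θ₁ − Θ₁` (`ē(P, Q^a) = ē(P, Q)^a`, Lang VII §2 Prop. 3, then Prop. 4).
[cite: Lang1983AbelianVarieties, Ch. VII §2 Prop. 3 and Prop. 4] -/
theorem weilDiv_linEquiv_weilDiv_zpow_of_forall_weilPairingLevel_eq_zpow {N : ℕ} (hNK : (N : K) ≠ 0)
    [IsDominant (Hom.toSchemeHom ((N : ℤ) • 𝟙 A))]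
    (Θ₁ Θ₂ : CartierDivisor A.X.left) (Q : A.torsionPoints K N) (a : ℤ)
    (h : ∀ P : A.torsionPoints K N, A.weilPairingLevel Θ₂ P Q = A.weilPairingLevel Θ₁ P Q ^ a) :
    (A.weilDiv Θ₂ Q.1).LinEquiv (A.weilDiv Θ₁ (Q.1 ^ a)) := by
  have h' : ∀ P : A.torsionPoints K N, A.weilPairingLevel Θ₂ P Q = A.weilPairingLevel Θ₁ P (Q ^ a) := by
    intro P
    rw [h P, ← val_weilPairingLevelRightHom_apply, ← val_weilPairingLevelRightHom_apply, map_zpow,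
      Units.val_zpow_eq_zpow_val]
  exact weilDiv_linEquiv_weilDiv_of_forall_weilPairingLevel_eq_of_isAlgClosed hNK Θ₁ Θ₂ (Q ^ a) Q h'

end AlgClosed

end AbelianVariety

end Literature.AlgebraicGeometry.Motives

end
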